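import Mathlib
import Summits.Ventures.PercRepro2.Defs
import Summits.Ventures.PercRepro2.Graph
import Summits.Ventures.PercRepro2.OneColourSwitch
import Summits.Ventures.PercRepro2.RegionHubSign
import Summits.Ventures.PercRepro2.SideSwitch
import Summits.Ventures.PercRepro2.SideSwitchComps
import Summits.Ventures.PercRepro2.M9NoPocketDefs
import Summits.Ventures.PercRepro2.M9PocketRSEdgeTransfer
import Summits.Ventures.PercRepro2.M9PocketRSEdgeSumT
import Summits.Ventures.PercRepro2.M9PocketRootOnlyTransfer

/-!
# Root-only clusters factor out of the single-`d` sign sum (blind cell PercRepro2, p3 g41,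
2026-08-29; `proofs/P3-POCKETRK.md` §10⁵: the first linking blocks in the kernel)

Let `L` be a root-only cluster (every edge at a vertex of `L` ends in `L`, `r` or `s`;
`p, q, r, s, d ∉ L`) and `F` the edges inside `L ∪ {r, s}`.  A colouring of `G` is a colouring
`ω'` of the edges off `F` glued with a colouring `τ` of `F` (`Equiv.piEquivPiSubtypeProd`).  By
`M9PocketRootOnlyTransfer`, `Sep ∧ DOne` of the glued colouring is `Sep ∧ DOne` of `ω'`
together with «no vertex of `L` in both worlds of the `F`-graph under `τ`» (`legal_glue_iff`),
`σ_pq` is that of `ω'`, and `r ~_Y s` is the disjunction of the two graphs' links.  Summing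
`σ_rs` over the admissible `τ`, the colour flip of `τ` exchanges the `Y`- and `W`-links of the
`F`-graph, and what remains is `κ · σ_rs(ω')` with `κ ≥ 0` the number of admissible `τ` without
an `F`-link (`sum_sigma_rs_glue_rootOnly`).  Hence
**`dSignSum_eq_mul_restrict_rootOnly`**: `dSignSum G = κ · dSignSum (G − F)` — the single-`d`
sign sum of `G` is a non-negative multiple of the one of `G` with the cluster's edges removed,
for EVERY `p, q, d` — and the single-`d` theorems on the non-linking class apply to `G − F`:
* **`dSignSum_nonpos_of_rootOnly_sepN'`** — `dSignSum ≤ 0` when, in `G` minus the edges inside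
  `L ∪ {r, s}`, no `r`–`s` path of `G − d` has all its vertices among the non-neighbours of `d`
  and `r`, `s`;
* **`dSignSum_nonpos_of_nbrs_adj_d_rootOnly`** — every neighbour of `r` or `s` other than
  `r, s, d` is a neighbour of `d` OR lies in `L`: the neighbours class of
  `dSignSum_nonpos_of_nbrs_adj_d'_T` with arbitrary unattached linking blocks.
The case `L = ∅` is `M9PocketRSEdgeSum` (the edges inside `{r, s}`).  Own work; std axioms.
-/

namespace Summit.Ventures.PercRepro2

namespace NoPocket

open Finset Classical OneColourSwitch SideSwitch

variable {V : Type*} {E : Type*} {ends : E → Sym2 V} {p q r s d : V} {L : Set V}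

section Glue

/-- The restriction of the glued colouring to the edges off `F` is its first component. -/
lemma restrict_glue_rootOnly (ω' : {e // e ∉ within ends (L ∪ {r, s} : Set V)} → Bool)
    (τ : {e // ¬ (e ∉ within ends (L ∪ {r, s} : Set V))} → Bool) :
    (fun e : {e // e ∉ within ends (L ∪ {r, s} : Set V)} =>
      (Equiv.piEquivPiSubtypeProd (fun e => e ∉ within ends (L ∪ {r, s} : Set V))
        (fun _ => Bool)).symm (ω', τ) e.1) = ω' := by
  funext e
  rw [Equiv.piEquivPiSubtypeProd_symm_apply]
  exact dif_pos e.2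

/-- The restriction of the glued colouring to `F` is its second component. -/
lemma restrictF_glue_rootOnly (ω' : {e // e ∉ within ends (L ∪ {r, s} : Set V)} → Bool)
    (τ : {e // ¬ (e ∉ within ends (L ∪ {r, s} : Set V))} → Bool) :
    (fun e : {e // ¬ (e ∉ within ends (L ∪ {r, s} : Set V))} =>
      (Equiv.piEquivPiSubtypeProd (fun e => e ∉ within ends (L ∪ {r, s} : Set V))
        (fun _ => Bool)).symm (ω', τ) e.1) = τ := by
  funext e
  rw [Equiv.piEquivPiSubtypeProd_symm_apply]
  exact dif_neg e.2

/-- The colour flip commutes with the glue. -/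
lemma compl_glue_rootOnly (ω' : {e // e ∉ within ends (L ∪ {r, s} : Set V)} → Bool)
    (τ : {e // ¬ (e ∉ within ends (L ∪ {r, s} : Set V))} → Bool) :
    OneColourSwitch.compl ((Equiv.piEquivPiSubtypeProd
        (fun e => e ∉ within ends (L ∪ {r, s} : Set V)) (fun _ => Bool)).symm (ω', τ)) =
      (Equiv.piEquivPiSubtypeProd (fun e => e ∉ within ends (L ∪ {r, s} : Set V))
        (fun _ => Bool)).symm (OneColourSwitch.compl ω', OneColourSwitch.compl τ) := by
  funext e
  simp only [OneColourSwitch.compl, Equiv.piEquivPiSubtypeProd_symm_apply]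
  split_ifs <;> rfl

/-- **`Sep ∧ DOne` of the glued colouring**: `Sep ∧ DOne` of the restriction, and no vertex of
`L` in both worlds of the `F`-graph under `τ`. -/
lemma legal_glue_iff (hL : ∀ e x y, ends e = s(x, y) → x ∈ L → y ∈ L ∨ y = r ∨ y = s)
    (hp : p ∉ L) (hq : q ∉ L) (hr : r ∉ L) (hs : s ∉ L) (hd : d ∉ L)
    (ω' : {e // e ∉ within ends (L ∪ {r, s} : Set V)} → Bool)
    (τ : {e // ¬ (e ∉ within ends (L ∪ {r, s} : Set V))} → Bool) :
    (sep2 ends p q r s ((Equiv.piEquivPiSubtypeProd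
        (fun e => e ∉ within ends (L ∪ {r, s} : Set V)) (fun _ => Bool)).symm (ω', τ)) ∧
      DOne ends r s d ((Equiv.piEquivPiSubtypeProd
        (fun e => e ∉ within ends (L ∪ {r, s} : Set V)) (fun _ => Bool)).symm (ω', τ))) ↔
    ((sep2 (fun e : {e // e ∉ within ends (L ∪ {r, s} : Set V)} => ends e.1) p q r s ω' ∧
      DOne (fun e : {e // e ∉ within ends (L ∪ {r, s} : Set V)} => ends e.1) r s d ω') ∧
      ∀ x ∈ L, x ∈ K2 (fun e : {e // ¬ (e ∉ within ends (L ∪ {r, s} : Set V))} => ends e.1)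
          r s τ →
        x ∉ M2 (fun e : {e // ¬ (e ∉ within ends (L ∪ {r, s} : Set V))} => ends e.1) r s τ) := by
  rw [sep2_restrict_iff_rootOnly hL hp hq, DOne_restrict_iff_rootOnly hL hr hs hd,
    restrict_glue_rootOnly, restrictF_glue_rootOnly]
  tauto

/-- **`σ_pq` of the glued colouring** is that of the restriction at a `Sep` point. -/
lemma sigma_pq_glue_eq_rootOnly
    (hL : ∀ e x y, ends e = s(x, y) → x ∈ L → y ∈ L ∨ y = r ∨ y = s) (hp : p ∉ L)
    (ω' : {e // e ∉ within ends (L ∪ {r, s} : Set V)} → Bool)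
    (τ : {e // ¬ (e ∉ within ends (L ∪ {r, s} : Set V))} → Bool)
    (hsep : sep2 ends p q r s ((Equiv.piEquivPiSubtypeProd
      (fun e => e ∉ within ends (L ∪ {r, s} : Set V)) (fun _ => Bool)).symm (ω', τ))) :
    sigma ends ((Equiv.piEquivPiSubtypeProd
        (fun e => e ∉ within ends (L ∪ {r, s} : Set V)) (fun _ => Bool)).symm (ω', τ)) p q =
      sigma (fun e : {e // e ∉ within ends (L ∪ {r, s} : Set V)} => ends e.1) ω' p q := by
  rw [sigma_pq_restrict_eq_rootOnly hL hp hsep, restrict_glue_rootOnly]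

/-- **`r ~_Y s` at the glued colouring**: an `r`–`s` link off `F` or one inside the `F`-graph. -/
lemma conn_rs_glue_iff_rootOnly
    (hL : ∀ e x y, ends e = s(x, y) → x ∈ L → y ∈ L ∨ y = r ∨ y = s) (hr : r ∉ L) (hs : s ∉ L)
    (ω' : {e // e ∉ within ends (L ∪ {r, s} : Set V)} → Bool)
    (τ : {e // ¬ (e ∉ within ends (L ∪ {r, s} : Set V))} → Bool) :
    Conn ends ((Equiv.piEquivPiSubtypeProd
        (fun e => e ∉ within ends (L ∪ {r, s} : Set V)) (fun _ => Bool)).symm (ω', τ)) r s ↔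
      Conn (fun e : {e // e ∉ within ends (L ∪ {r, s} : Set V)} => ends e.1) ω' r s ∨
        Conn (fun e : {e // ¬ (e ∉ within ends (L ∪ {r, s} : Set V))} => ends e.1) τ r s := by
  rw [conn_rs_restrict_iff_rootOnly hL hr hs, restrict_glue_rootOnly, restrictF_glue_rootOnly]

/-- **`r ~_W s` at the glued colouring.** -/
lemma conn_compl_rs_glue_iff_rootOnly
    (hL : ∀ e x y, ends e = s(x, y) → x ∈ L → y ∈ L ∨ y = r ∨ y = s) (hr : r ∉ L) (hs : s ∉ L)
    (ω' : {e // e ∉ within ends (L ∪ {r, s} : Set V)} → Bool)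
    (τ : {e // ¬ (e ∉ within ends (L ∪ {r, s} : Set V))} → Bool) :
    Conn ends (OneColourSwitch.compl ((Equiv.piEquivPiSubtypeProd
        (fun e => e ∉ within ends (L ∪ {r, s} : Set V)) (fun _ => Bool)).symm (ω', τ))) r s ↔
      Conn (fun e : {e // e ∉ within ends (L ∪ {r, s} : Set V)} => ends e.1)
          (OneColourSwitch.compl ω') r s ∨
        Conn (fun e : {e // ¬ (e ∉ within ends (L ∪ {r, s} : Set V))} => ends e.1)
          (OneColourSwitch.compl τ) r s := by
  rw [compl_glue_rootOnly, conn_rs_glue_iff_rootOnly hL hr hs]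

/-- The admissibility of `τ` («no vertex of `L` in both worlds of the `F`-graph») is invariant
under the colour flip of `τ`. -/
lemma admissible_compl_iff (τ : {e // ¬ (e ∉ within ends (L ∪ {r, s} : Set V))} → Bool) :
    (∀ x ∈ L, x ∈ K2 (fun e : {e // ¬ (e ∉ within ends (L ∪ {r, s} : Set V))} => ends e.1) r s
        (OneColourSwitch.compl τ) →
      x ∉ M2 (fun e : {e // ¬ (e ∉ within ends (L ∪ {r, s} : Set V))} => ends e.1) r s
        (OneColourSwitch.compl τ)) ↔
    (∀ x ∈ L, x ∈ K2 (fun e : {e // ¬ (e ∉ within ends (L ∪ {r, s} : Set V))} => ends e.1) r s τ →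
      x ∉ M2 (fun e : {e // ¬ (e ∉ within ends (L ∪ {r, s} : Set V))} => ends e.1) r s τ) := by
  simp only [K2_compl, M2_compl]
  constructor
  · intro h x hx h1 h2
    exact h x hx h2 h1
  · intro h x hx h1 h2
    exact h x hx h2 h1

end Glue

section Count

variable [Fintype E] [DecidableEq E]

/-- **The sum over the admissible colourings `τ` of `F` of `σ_rs`** is `κ · σ_rs` of the
restriction, `κ` = the number of admissible `τ` without an `r`–`s` link in the `F`-graph (the
colour flip of `τ` pairs the `Y`-linked `τ` with the `W`-linked ones). -/
lemma sum_sigma_rs_glue_rootOnly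
    (hL : ∀ e x y, ends e = s(x, y) → x ∈ L → y ∈ L ∨ y = r ∨ y = s) (hr : r ∉ L) (hs : s ∉ L)
    (ω' : {e // e ∉ within ends (L ∪ {r, s} : Set V)} → Bool) :
    (∑ τ : ({e // ¬ (e ∉ within ends (L ∪ {r, s} : Set V))} → Bool),
      if (∀ x ∈ L, x ∈ K2 (fun e : {e // ¬ (e ∉ within ends (L ∪ {r, s} : Set V))} => ends e.1)
          r s τ →
        x ∉ M2 (fun e : {e // ¬ (e ∉ within ends (L ∪ {r, s} : Set V))} => ends e.1) r s τ) then
        sigma ends ((Equiv.piEquivPiSubtypeProd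
          (fun e => e ∉ within ends (L ∪ {r, s} : Set V)) (fun _ => Bool)).symm (ω', τ)) r s
      else 0) =
    (∑ τ : ({e // ¬ (e ∉ within ends (L ∪ {r, s} : Set V))} → Bool),
      if (∀ x ∈ L, x ∈ K2 (fun e : {e // ¬ (e ∉ within ends (L ∪ {r, s} : Set V))} => ends e.1)
          r s τ →
        x ∉ M2 (fun e : {e // ¬ (e ∉ within ends (L ∪ {r, s} : Set V))} => ends e.1) r s τ) ∧
        ¬ Conn (fun e : {e // ¬ (e ∉ within ends (L ∪ {r, s} : Set V))} => ends e.1) τ r s then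
        (1 : ℤ) else 0) *
    sigma (fun e : {e // e ∉ within ends (L ∪ {r, s} : Set V)} => ends e.1) ω' r s := by
  -- the summand, written with the two links of the `F`-graph
  have h1 : ∀ τ : ({e // ¬ (e ∉ within ends (L ∪ {r, s} : Set V))} → Bool),
      (if (∀ x ∈ L, x ∈ K2 (fun e : {e // ¬ (e ∉ within ends (L ∪ {r, s} : Set V))} => ends e.1)
          r s τ →
        x ∉ M2 (fun e : {e // ¬ (e ∉ within ends (L ∪ {r, s} : Set V))} => ends e.1) r s τ) then
        sigma ends ((Equiv.piEquivPiSubtypeProd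
          (fun e => e ∉ within ends (L ∪ {r, s} : Set V)) (fun _ => Bool)).symm (ω', τ)) r s
      else 0) =
      (if (∀ x ∈ L, x ∈ K2 (fun e : {e // ¬ (e ∉ within ends (L ∪ {r, s} : Set V))} => ends e.1)
          r s τ →
        x ∉ M2 (fun e : {e // ¬ (e ∉ within ends (L ∪ {r, s} : Set V))} => ends e.1) r s τ) ∧
        (Conn (fun e : {e // e ∉ within ends (L ∪ {r, s} : Set V)} => ends e.1) ω' r s ∨
          Conn (fun e : {e // ¬ (e ∉ within ends (L ∪ {r, s} : Set V))} => ends e.1) τ r s) then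
        (1 : ℤ) else 0) -
      (if (∀ x ∈ L, x ∈ K2 (fun e : {e // ¬ (e ∉ within ends (L ∪ {r, s} : Set V))} => ends e.1)
          r s τ →
        x ∉ M2 (fun e : {e // ¬ (e ∉ within ends (L ∪ {r, s} : Set V))} => ends e.1) r s τ) ∧
        (Conn (fun e : {e // e ∉ within ends (L ∪ {r, s} : Set V)} => ends e.1)
            (OneColourSwitch.compl ω') r s ∨
          Conn (fun e : {e // ¬ (e ∉ within ends (L ∪ {r, s} : Set V))} => ends e.1)
            (OneColourSwitch.compl τ) r s) then (1 : ℤ) else 0) := by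
    intro τ
    unfold sigma
    rw [if_congr (conn_rs_glue_iff_rootOnly hL hr hs ω' τ) rfl rfl,
      if_congr (conn_compl_rs_glue_iff_rootOnly hL hr hs ω' τ) rfl rfl]
    by_cases hA : ∀ x ∈ L, x ∈ K2 (fun e : {e // ¬ (e ∉ within ends (L ∪ {r, s} : Set V))} =>
        ends e.1) r s τ →
      x ∉ M2 (fun e : {e // ¬ (e ∉ within ends (L ∪ {r, s} : Set V))} => ends e.1) r s τ
    · rw [if_pos hA]
      by_cases hY : Conn (fun e : {e // e ∉ within ends (L ∪ {r, s} : Set V)} => ends e.1) ω' r s ∨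
          Conn (fun e : {e // ¬ (e ∉ within ends (L ∪ {r, s} : Set V))} => ends e.1) τ r s <;>
      by_cases hW : Conn (fun e : {e // e ∉ within ends (L ∪ {r, s} : Set V)} => ends e.1)
          (OneColourSwitch.compl ω') r s ∨
        Conn (fun e : {e // ¬ (e ∉ within ends (L ∪ {r, s} : Set V))} => ends e.1)
          (OneColourSwitch.compl τ) r s
      · rw [if_pos hY, if_pos hW, if_pos ⟨hA, hY⟩, if_pos ⟨hA, hW⟩]
      · rw [if_pos hY, if_neg hW, if_pos ⟨hA, hY⟩, if_neg (fun h => hW h.2)]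
      · rw [if_neg hY, if_pos hW, if_neg (fun h => hY h.2), if_pos ⟨hA, hW⟩]
      · rw [if_neg hY, if_neg hW, if_neg (fun h => hY h.2), if_neg (fun h => hW h.2)]
    · rw [if_neg hA, if_neg (fun h => hA h.1), if_neg (fun h => hA h.1)]
      ring
  -- the `W` count equals the `Y` count by the colour flip of `τ`
  have h2 : ∑ τ : ({e // ¬ (e ∉ within ends (L ∪ {r, s} : Set V))} → Bool),
      (if (∀ x ∈ L, x ∈ K2 (fun e : {e // ¬ (e ∉ within ends (L ∪ {r, s} : Set V))} => ends e.1)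
          r s τ →
        x ∉ M2 (fun e : {e // ¬ (e ∉ within ends (L ∪ {r, s} : Set V))} => ends e.1) r s τ) ∧
        (Conn (fun e : {e // e ∉ within ends (L ∪ {r, s} : Set V)} => ends e.1)
            (OneColourSwitch.compl ω') r s ∨
          Conn (fun e : {e // ¬ (e ∉ within ends (L ∪ {r, s} : Set V))} => ends e.1)
            (OneColourSwitch.compl τ) r s) then (1 : ℤ) else 0) =
      ∑ τ : ({e // ¬ (e ∉ within ends (L ∪ {r, s} : Set V))} → Bool),
      (if (∀ x ∈ L, x ∈ K2 (fun e : {e // ¬ (e ∉ within ends (L ∪ {r, s} : Set V))} => ends e.1)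
          r s τ →
        x ∉ M2 (fun e : {e // ¬ (e ∉ within ends (L ∪ {r, s} : Set V))} => ends e.1) r s τ) ∧
        (Conn (fun e : {e // e ∉ within ends (L ∪ {r, s} : Set V)} => ends e.1)
            (OneColourSwitch.compl ω') r s ∨
          Conn (fun e : {e // ¬ (e ∉ within ends (L ∪ {r, s} : Set V))} => ends e.1) τ r s) then
        (1 : ℤ) else 0) := by
    rw [← Equiv.sum_comp (Function.Involutive.toPerm
      (OneColourSwitch.compl (E := {e // ¬ (e ∉ within ends (L ∪ {r, s} : Set V))}))
      OneColourSwitch.compl_compl)]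
    refine Finset.sum_congr rfl fun τ _ => ?_
    simp only [Function.Involutive.coe_toPerm, OneColourSwitch.compl_compl]
    exact if_congr (and_congr (admissible_compl_iff τ) Iff.rfl) rfl rfl
  rw [Finset.sum_congr rfl fun τ _ => h1 τ, Finset.sum_sub_distrib, h2, ← Finset.sum_sub_distrib,
    Finset.sum_mul]
  refine Finset.sum_congr rfl fun τ _ => ?_
  unfold sigma
  by_cases hA : ∀ x ∈ L, x ∈ K2 (fun e : {e // ¬ (e ∉ within ends (L ∪ {r, s} : Set V))} =>
      ends e.1) r s τ →
    x ∉ M2 (fun e : {e // ¬ (e ∉ within ends (L ∪ {r, s} : Set V))} => ends e.1) r s τ <;>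
  by_cases hF : Conn (fun e : {e // ¬ (e ∉ within ends (L ∪ {r, s} : Set V))} => ends e.1) τ r s <;>
  by_cases hY : Conn (fun e : {e // e ∉ within ends (L ∪ {r, s} : Set V)} => ends e.1) ω' r s <;>
  by_cases hW : Conn (fun e : {e // e ∉ within ends (L ∪ {r, s} : Set V)} => ends e.1)
      (OneColourSwitch.compl ω') r s <;>
  simp [hA, hF, hY, hW]

/-- **The single-`d` sign sum of `G` is a non-negative multiple of the one of `G` with the edges
inside `L ∪ {r, s}` removed** (`κ` = the number of admissible colourings of those edges without
an `r`–`s` link through them). -/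
theorem dSignSum_eq_mul_restrict_rootOnly
    (hL : ∀ e x y, ends e = s(x, y) → x ∈ L → y ∈ L ∨ y = r ∨ y = s)
    (hp : p ∉ L) (hq : q ∉ L) (hr : r ∉ L) (hs : s ∉ L) (hd : d ∉ L) :
    dSignSum ends p q r s d =
    (∑ τ : ({e // ¬ (e ∉ within ends (L ∪ {r, s} : Set V))} → Bool),
      if (∀ x ∈ L, x ∈ K2 (fun e : {e // ¬ (e ∉ within ends (L ∪ {r, s} : Set V))} => ends e.1)
          r s τ →
        x ∉ M2 (fun e : {e // ¬ (e ∉ within ends (L ∪ {r, s} : Set V))} => ends e.1) r s τ) ∧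
        ¬ Conn (fun e : {e // ¬ (e ∉ within ends (L ∪ {r, s} : Set V))} => ends e.1) τ r s then
        (1 : ℤ) else 0) *
    dSignSum (fun e : {e // e ∉ within ends (L ∪ {r, s} : Set V)} => ends e.1) p q r s d := by
  unfold dSignSum
  rw [← (Equiv.piEquivPiSubtypeProd (fun e => e ∉ within ends (L ∪ {r, s} : Set V))
    (fun _ => Bool)).symm.sum_comp, Fintype.sum_prod_type, Finset.mul_sum]
  refine Finset.sum_congr rfl fun ω' _ => ?_
  by_cases h : sep2 (fun e : {e // e ∉ within ends (L ∪ {r, s} : Set V)} => ends e.1) p q r s ω' ∧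
      DOne (fun e : {e // e ∉ within ends (L ∪ {r, s} : Set V)} => ends e.1) r s d ω'
  · rw [if_pos h]
    calc ∑ τ : ({e // ¬ (e ∉ within ends (L ∪ {r, s} : Set V))} → Bool),
          (if sep2 ends p q r s ((Equiv.piEquivPiSubtypeProd
              (fun e => e ∉ within ends (L ∪ {r, s} : Set V)) (fun _ => Bool)).symm (ω', τ)) ∧
              DOne ends r s d ((Equiv.piEquivPiSubtypeProd
              (fun e => e ∉ within ends (L ∪ {r, s} : Set V)) (fun _ => Bool)).symm (ω', τ)) then
            sigma ends ((Equiv.piEquivPiSubtypeProd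
              (fun e => e ∉ within ends (L ∪ {r, s} : Set V)) (fun _ => Bool)).symm (ω', τ)) p q *
            sigma ends ((Equiv.piEquivPiSubtypeProd
              (fun e => e ∉ within ends (L ∪ {r, s} : Set V)) (fun _ => Bool)).symm (ω', τ)) r s
          else 0)
        = ∑ τ : ({e // ¬ (e ∉ within ends (L ∪ {r, s} : Set V))} → Bool),
          sigma (fun e : {e // e ∉ within ends (L ∪ {r, s} : Set V)} => ends e.1) ω' p q *
          (if (∀ x ∈ L, x ∈ K2 (fun e : {e // ¬ (e ∉ within ends (L ∪ {r, s} : Set V))} =>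
              ends e.1) r s τ →
            x ∉ M2 (fun e : {e // ¬ (e ∉ within ends (L ∪ {r, s} : Set V))} => ends e.1) r s τ)
          then sigma ends ((Equiv.piEquivPiSubtypeProd
              (fun e => e ∉ within ends (L ∪ {r, s} : Set V)) (fun _ => Bool)).symm (ω', τ)) r s
          else 0) := by
          refine Finset.sum_congr rfl fun τ _ => ?_
          by_cases hA : ∀ x ∈ L, x ∈ K2 (fun e : {e // ¬ (e ∉ within ends (L ∪ {r, s} : Set V))} =>
              ends e.1) r s τ →
            x ∉ M2 (fun e : {e // ¬ (e ∉ within ends (L ∪ {r, s} : Set V))} => ends e.1) r s τ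
          · have hg := (legal_glue_iff hL hp hq hr hs hd ω' τ).2 ⟨h, hA⟩
            rw [if_pos hg, if_pos hA, sigma_pq_glue_eq_rootOnly hL hp ω' τ hg.1]
          · rw [if_neg (fun hg => hA ((legal_glue_iff hL hp hq hr hs hd ω' τ).1 hg).2), if_neg hA,
              mul_zero]
      _ = sigma (fun e : {e // e ∉ within ends (L ∪ {r, s} : Set V)} => ends e.1) ω' p q *
          ∑ τ : ({e // ¬ (e ∉ within ends (L ∪ {r, s} : Set V))} → Bool),
          (if (∀ x ∈ L, x ∈ K2 (fun e : {e // ¬ (e ∉ within ends (L ∪ {r, s} : Set V))} =>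
              ends e.1) r s τ →
            x ∉ M2 (fun e : {e // ¬ (e ∉ within ends (L ∪ {r, s} : Set V))} => ends e.1) r s τ)
          then sigma ends ((Equiv.piEquivPiSubtypeProd
              (fun e => e ∉ within ends (L ∪ {r, s} : Set V)) (fun _ => Bool)).symm (ω', τ)) r s
          else 0) := by rw [Finset.mul_sum]
      _ = _ := by rw [sum_sigma_rs_glue_rootOnly hL hr hs]; ring
  · rw [if_neg h, mul_zero]
    refine Finset.sum_eq_zero fun τ _ => ?_
    rw [if_neg (fun hg => h ((legal_glue_iff hL hp hq hr hs hd ω' τ).1 hg).1)]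

end Count

section Main

variable [Fintype V] [DecidableEq V] [Fintype E] [DecidableEq E]

/-- **`dSignSum ≤ 0` with a root-only cluster `L`**: when, in `G` minus the edges inside
`L ∪ {r, s}`, no `r`–`s` path of `G − d` has all its vertices among the non-neighbours of `d`
and `r`, `s` (the separation hypothesis of `dSignSum_nonpos_of_sepN'_T` read on that graph). -/
theorem dSignSum_nonpos_of_rootOnly_sepN'
    (hL : ∀ e x y, ends e = s(x, y) → x ∈ L → y ∈ L ∨ y = r ∨ y = s)
    (hp : p ∉ L) (hq : q ∉ L) (hr : r ∉ L) (hs : s ∉ L) (hd : d ∉ L) (hdr : d ≠ r) (hds : d ≠ s)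
    (hsepN : ¬ Conn (endsD (fun e : {e // e ∉ within ends (L ∪ {r, s} : Set V)} => ends e.1) d)
      (chi (endsD (fun e : {e // e ∉ within ends (L ∪ {r, s} : Set V)} => ends e.1) d)
        ({x : V | ∀ e : {e // e ∉ within ends (L ∪ {r, s} : Set V)}, ends e.1 ≠ s(d, x)} ∪ {r, s}))
      r s) :
    dSignSum ends p q r s d ≤ 0 := by
  rw [dSignSum_eq_mul_restrict_rootOnly hL hp hq hr hs hd]
  refine mul_nonpos_iff.2 (Or.inl ⟨Finset.sum_nonneg fun τ _ => by split_ifs <;> norm_num, ?_⟩)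
  exact dSignSum_nonpos_of_sepN'_T hdr hds hsepN

/-- **The neighbours class with unattached linking blocks**: every neighbour of `r` or `s` other
than `r, s, d` is a neighbour of `d` or lies in the root-only cluster `L` ⇒ `dSignSum ≤ 0`
(`T`-edges, edges inside `{r, s}` and the structure of `L` arbitrary). -/
theorem dSignSum_nonpos_of_nbrs_adj_d_rootOnly
    (hL : ∀ e x y, ends e = s(x, y) → x ∈ L → y ∈ L ∨ y = r ∨ y = s)
    (hp : p ∉ L) (hq : q ∉ L) (hr : r ∉ L) (hs : s ∉ L) (hd : d ∉ L) (hdr : d ≠ r) (hds : d ≠ s)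
    (hnb : ∀ e x, (ends e = s(r, x) ∨ ends e = s(s, x)) → x ≠ r → x ≠ s → x ≠ d → x ∉ L →
      ∃ e', ends e' = s(d, x)) :
    dSignSum ends p q r s d ≤ 0 := by
  rw [dSignSum_eq_mul_restrict_rootOnly hL hp hq hr hs hd]
  refine mul_nonpos_iff.2 (Or.inl ⟨Finset.sum_nonneg fun τ _ => by split_ifs <;> norm_num, ?_⟩)
  refine dSignSum_nonpos_of_nbrs_adj_d'_T hdr hds ?_
  intro e x hex hxr hxs hxd
  -- the edge is off `F`, so its endpoint `x` is off `L`
  have hxL : x ∉ L := by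
    intro hxL
    rcases hex with hex | hex
    · exact e.2 (mem_within_of_mem_L hL (by rw [hex, Sym2.eq_swap]) hxL)
    · exact e.2 (mem_within_of_mem_L hL (by rw [hex, Sym2.eq_swap]) hxL)
  obtain ⟨e', he'⟩ := hnb e.1 x hex hxr hxs hxd hxL
  -- the edge `d x` is off `F` since `d ∉ L ∪ {r, s}`
  refine ⟨⟨e', ?_⟩, he'⟩
  intro hF
  have hdS := (mem_of_mem_within hF he').1
  simp only [Set.mem_union, Set.mem_insert_iff, Set.mem_singleton_iff] at hdS
  rcases hdS with h | h | h
  · exact hd h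
  · exact hdr h
  · exact hds h

end Main

end NoPocket

end Summit.Ventures.PercRepro2
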